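import Summits.BirchSwinnertonDyer.Rank1Residual.Additive.X3BranchKummerLayerTwisted
import HarnessLib

/-!
# X3, the DEGENERATE rows OFF the sub-locus: the twisted Kummer character VANISHES ON EVERY CONJUGATE
# OF AN INERTIA GROUP FIXING THE RADICALS (cell `bsd-eis`, seat `bsd-eis-x3` gen 7; third brick of the
# T-side over the first layer `ℚ_1` (MEMO-9 §2.4 (f)), sequel of `X3BranchKummerLayerTwisted.lean`,
# feeding `LayerAddChar.mem_unramifiedOutside_of_addCharOn`; route K1 `AdditiveBranchIMC`, crux
# `GordTwoRankZeroOffCaseOne` — supports only)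

HONEST FRAMING (`run/shared/lean/pub/bsd-eis/README.md` §4): THEOREMS ONLY (no `def`, no named fact,
no `sorry`); nothing is booked; no label, tier or count of record moves.

## What

`LayerAddChar.mem_unramifiedOutside_of_addCharOn` asks, at a finite `v ∉ S₀ ∪ {3}`, that the character
vanish at `σ⁻¹τσ` for every `σ ∈ Γ_ℚ` and every `τ` in the inertia group `I_v` of the chosen place.
For the twisted Kummer character `χ` of `KummerLayerTwisted.exists_twistedKummerChar` (radical
`β³ = b`) this follows from three facts the consumer supplies from the tree: `I_v` FIXES EVERY CONJUGATE
RADICAL `σβ` (the inertia lemma `KummerLayerLocal.smul_eq_self_of_mem_inertia_of_pow_eq_of_dvd`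
applied to `σb`, an algebraic integer with a `Σ₀`-supported norm multiple), `I_v` fixes `ζ₃` (`v ∤ 3`),
and `σ⁻¹ I_v σ ⊆ G'` (`G'` normal containing `I_v`):
* `smul_zeta_eq_of_conj` — `(σ⁻¹τσ)ζ = ζ` when `τ` fixes `ζ` and `ζ²`;
* `twistedChar_conj_eq_zero` — `χ(σ⁻¹τσ) = 0`.
References: [SerreLocalFields1979] Ch. X §3; [GreenbergVatsal2000] §2 pp. 16, 23, 28.
-/

set_option autoImplicit false

noncomputable section

open scoped Classical

namespace Summit.BirchSwinnertonDyer.Rank1Residual.Additive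

namespace KummerLayerTwisted

open Field Literature.NumberTheory.GaloisRepresentations KummerLineClasses

/-- **`(σ⁻¹τσ)ζ = ζ`** when `τ` fixes the primitive cube root of unity `ζ` (hence `ζ²`): `σζ ∈ {ζ, ζ²}`
is fixed by `τ`. [folklore] -/
theorem smul_zeta_eq_of_conj {ζ : AlgebraicClosure ℚ} (hζ : IsPrimitiveRoot ζ 3)
    {τ : absoluteGaloisGroup ℚ} (hτ : τ • ζ = ζ) (σ : absoluteGaloisGroup ℚ) :
    (σ⁻¹ * τ * σ) • ζ = ζ := by
  rw [mul_smul, mul_smul]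
  rcases smul_zeta_eq_or hζ σ with h | h
  · rw [h, hτ, inv_smul_eq_iff, h]
  · rw [h, smul_pow', hτ, inv_smul_eq_iff, h]

/-- **The twisted Kummer character vanishes on every conjugate of an inertia group fixing the
radicals.** `χ` with the value clause of `exists_twistedKummerChar` on `G'` (`σζ = ζ ⇒ σβ = ζⁿβ,
χ(σ) = n`); `τ` fixing `ζ` and every conjugate radical `σβ`; `σ⁻¹τσ ∈ G'`. Then `χ(σ⁻¹τσ) = 0`.
[cite: SerreLocalFields1979, Ch. X §3] -/
theorem twistedChar_conj_eq_zero {G' : Subgroup (absoluteGaloisGroup ℚ)}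
    {ζ : AlgebraicClosure ℚ} (hζ : IsPrimitiveRoot ζ 3) {β : AlgebraicClosure ℚ} (hβ0 : β ≠ 0)
    {χ : absoluteGaloisGroup ℚ → ZMod 3}
    (hχ : ∀ σ ∈ G', σ • ζ = ζ → ∃ n : ℕ, σ • β = ζ ^ n * β ∧ χ σ = n)
    {τ : absoluteGaloisGroup ℚ} (hτζ : τ • ζ = ζ) (σ : absoluteGaloisGroup ℚ)
    (hτβ : τ • (σ • β) = σ • β) (hG' : σ⁻¹ * τ * σ ∈ G') :
    χ (σ⁻¹ * τ * σ) = 0 := by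
  have hz := smul_zeta_eq_of_conj hζ hτζ σ
  obtain ⟨n, hn, hχn⟩ := hχ _ hG' hz
  have hfix : (σ⁻¹ * τ * σ) • β = β := by
    rw [mul_smul, mul_smul, hτβ, ← mul_smul, inv_mul_cancel, one_smul]
  rw [hfix] at hn
  have key : ζ ^ 0 * β = ζ ^ n * β := by rw [pow_zero, one_mul]; exact hn
  have h := natCast_eq_of_pow_mul_eq' hζ hβ0 key
  rw [hχn, ← h, Nat.cast_zero]

/-- **Corollary in the shape `LayerAddChar.mem_unramifiedOutside_of_addCharOn` consumes**: if every
`τ` in a set `I` (an inertia group) fixes `ζ` and all conjugate radicals `σβ`, and `σ⁻¹ I σ ⊆ G'` for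
all `σ`, then `χ(σ⁻¹τσ) = 0` for all `σ` and all `τ ∈ I`. [folklore] -/
theorem twistedChar_conj_eq_zero_of_forall {G' : Subgroup (absoluteGaloisGroup ℚ)}
    {ζ : AlgebraicClosure ℚ} (hζ : IsPrimitiveRoot ζ 3) {β : AlgebraicClosure ℚ} (hβ0 : β ≠ 0)
    {χ : absoluteGaloisGroup ℚ → ZMod 3}
    (hχ : ∀ σ ∈ G', σ • ζ = ζ → ∃ n : ℕ, σ • β = ζ ^ n * β ∧ χ σ = n)
    (I : Subgroup (absoluteGaloisGroup ℚ)) (hIζ : ∀ τ ∈ I, τ • ζ = ζ)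
    (hIβ : ∀ τ ∈ I, ∀ σ : absoluteGaloisGroup ℚ, τ • (σ • β) = σ • β)
    (hIG : ∀ τ ∈ I, ∀ σ : absoluteGaloisGroup ℚ, σ⁻¹ * τ * σ ∈ G') :
    ∀ σ : absoluteGaloisGroup ℚ, ∀ τ ∈ I, χ (σ⁻¹ * τ * σ) = 0 :=
  fun σ τ hτ ↦ twistedChar_conj_eq_zero hζ hβ0 hχ (hIζ τ hτ) σ (hIβ τ hτ σ) (hIG τ hτ σ)

end KummerLayerTwisted

end Summit.BirchSwinnertonDyer.Rank1Residual.Additive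

end
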